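import Summits.BirchSwinnertonDyer.BirchSwinnertonDyer.Theorems.ManinLocalTwoThreeManinPrimeToThreeAtNineKatoShiftLever

/-!
# Route `ManinLocalTwoThree`, crux C3 `ManinPrimeToThreeAtNine` (stmt-BirchSwinnertonDyer-22968): the residual split along
# reductions to CLASS PREDICATES that may use the minimal model and the level (line prover p1; helper)

Sequel to `…ManinPrimeToThreeAtNineGenericResidualSplit` (p592990/p593345) with the predicate typed
`Q : ∀ W [W.IsElliptic] [W.IsGloballyMinimal] N [NeZero N], Prop`, so that seat p2's twist-orbit-minimal clauses
(which mention `W.minimalDiscriminantInt` and data at level `N`) and every future class-level reduction plug in directly: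
`maninPrimeToThreeAtNine_of_classReduction_of_split`, `…_of_classReduction_of_katoShift`,
`…_of_classReduction_of_katoFact_of_generation`, `maninPrimeToThreeAtNine_iff_split_of_classReduction` (lossless, granted
`PrintedSemistableManinFacts`). The orbit-minimal instance itself is seat p2's
`maninLocalTwoThree_maninPrimeToThreeAtNine_of_katoFact_of_generation_of_orbitMinimalReducible`.
HONEST FRAMING: `proof.conditional`; nothing about BSD or Manin's conjecture at `3` is proved here.
-/

set_option autoImplicit false
set_option linter.dupNamespace false

noncomputable section

open scoped Classical MatrixGroups ModularForm

open CongruenceSubgroup WeierstrassCurve Literature.NumberTheory.EllipticCurves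
  Literature.NumberTheory.EllipticCurves.ModularForms
  Summit.BirchSwinnertonDyer.Rank1Residual.ManinAdditive

namespace Summit.BirchSwinnertonDyer.BirchSwinnertonDyer.Theorems.ManinLocalTwoThree

/-! ### Class predicates that may use the minimal model and the level structure (as for C2) -/

section ClassPredicate

variable (Q : ∀ (W : WeierstrassCurve ℚ) [W.IsElliptic] [W.IsGloballyMinimal] (N : ℕ) [NeZero N], Prop)

/-- **Generic split of C3 along a reduction to a class predicate `Q`** (which may use the minimal model and the level).
[cite: Kato2004Asterisque, Thm. 9.7 (p. 189)] [cite: Stevens1989, Lemmas (5.2), (5.4)] -/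
theorem maninPrimeToThreeAtNine_of_classReduction_of_split
    (hred : (Literature.NumberTheory.EllipticCurves.ModularForms.mazur_not_dvd_maninConstant_of_odd →
      Literature.NumberTheory.EllipticCurves.ModularForms.abbesUllmo_not_dvd_maninConstant_of_not_dvd_level →
      Literature.NumberTheory.EllipticCurves.ModularForms.cesnavicius_not_two_dvd_maninConstant_of_two_dvd_level →
      Literature.NumberTheory.EllipticCurves.ModularForms.exists_isNewformOf →
      ∀ (W : WeierstrassCurve ℚ) [W.IsElliptic] [W.IsGloballyMinimal] {N : ℕ} [NeZero N]
        (D : ModularParametrizationData W N),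
        (∀ z ∈ D.L.lattice, ∃ w ∈ periodLattice D.f, z = D.c * w) → 3 ^ 2 ∣ N → Q W N →
        ¬ (3 : ℤ) ∣ D.maninConstant) →
      Summit.BirchSwinnertonDyer.BirchSwinnertonDyer.Theses.ManinLocalTwoThree.ManinPrimeToThreeAtNine)
    (hA : ∀ (W : WeierstrassCurve ℚ) [W.IsElliptic] [W.IsGloballyMinimal] {N : ℕ} [NeZero N]
      (D : ModularParametrizationData W N),
      (∀ z ∈ D.L.lattice, ∃ w ∈ periodLattice D.f, z = D.c * w) → 3 ^ 2 ∣ N →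
      Q W N → W.HasIrreducibleModPGaloisRep 3 → ¬ (3 : ℤ) ∣ D.c)
    (hB : ∀ (W : WeierstrassCurve ℚ) [W.IsElliptic] [W.IsGloballyMinimal] {N : ℕ} [NeZero N]
      (D : ModularParametrizationData W N),
      (∀ z ∈ D.L.lattice, ∃ w ∈ periodLattice D.f, z = D.c * w) → 3 ^ 2 ∣ N →
      Q W N → ¬ W.HasIrreducibleModPGaloisRep 3 → ¬ (3 : ℤ) ∣ D.c)
    : Summit.BirchSwinnertonDyer.BirchSwinnertonDyer.Theses.ManinLocalTwoThree.ManinPrimeToThreeAtNine :=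
  hred (fun _hM _hAU _hC _hnf W _ _ N _ D hopt h9 hQ => by
    show ¬ (3 : ℤ) ∣ D.c
    by_cases hirr : W.HasIrreducibleModPGaloisRep 3
    · exact hA W D hopt h9 hQ hirr
    · exact hB W D hopt h9 hQ hirr)

/-- **Generic split along a class-predicate reduction, certificate := E-es-18 `KatoShiftTwistManinThree`.**
[cite: Kato2004Asterisque, Thm. 9.7 (p. 189)] -/
theorem maninPrimeToThreeAtNine_of_classReduction_of_katoShift
    (hred : (Literature.NumberTheory.EllipticCurves.ModularForms.mazur_not_dvd_maninConstant_of_odd →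
      Literature.NumberTheory.EllipticCurves.ModularForms.abbesUllmo_not_dvd_maninConstant_of_not_dvd_level →
      Literature.NumberTheory.EllipticCurves.ModularForms.cesnavicius_not_two_dvd_maninConstant_of_two_dvd_level →
      Literature.NumberTheory.EllipticCurves.ModularForms.exists_isNewformOf →
      ∀ (W : WeierstrassCurve ℚ) [W.IsElliptic] [W.IsGloballyMinimal] {N : ℕ} [NeZero N]
        (D : ModularParametrizationData W N),
        (∀ z ∈ D.L.lattice, ∃ w ∈ periodLattice D.f, z = D.c * w) → 3 ^ 2 ∣ N → Q W N →
        ¬ (3 : ℤ) ∣ D.maninConstant) →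
      Summit.BirchSwinnertonDyer.BirchSwinnertonDyer.Theses.ManinLocalTwoThree.ManinPrimeToThreeAtNine)
    (hK3 : KatoShiftTwistManinThree)
    (hB : ∀ (W : WeierstrassCurve ℚ) [W.IsElliptic] [W.IsGloballyMinimal] {N : ℕ} [NeZero N]
      (D : ModularParametrizationData W N),
      (∀ z ∈ D.L.lattice, ∃ w ∈ periodLattice D.f, z = D.c * w) → 3 ^ 2 ∣ N →
      Q W N → ¬ W.HasIrreducibleModPGaloisRep 3 → ¬ (3 : ℤ) ∣ D.c)
    : Summit.BirchSwinnertonDyer.BirchSwinnertonDyer.Theses.ManinLocalTwoThree.ManinPrimeToThreeAtNine :=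
  maninPrimeToThreeAtNine_of_classReduction_of_split Q hred (fun W _ _ _ _ D hopt h9 _ hirr => hK3 W D hopt h9 hirr) hB

/-- **Generic split along a class-predicate reduction, certificate := F-es-18 ∧ E-es-19.**
[cite: Kato2004Asterisque, Thm. 9.7 (p. 189)] -/
theorem maninPrimeToThreeAtNine_of_classReduction_of_katoFact_of_generation
    (hred : (Literature.NumberTheory.EllipticCurves.ModularForms.mazur_not_dvd_maninConstant_of_odd →
      Literature.NumberTheory.EllipticCurves.ModularForms.abbesUllmo_not_dvd_maninConstant_of_not_dvd_level →
      Literature.NumberTheory.EllipticCurves.ModularForms.cesnavicius_not_two_dvd_maninConstant_of_two_dvd_level →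
      Literature.NumberTheory.EllipticCurves.ModularForms.exists_isNewformOf →
      ∀ (W : WeierstrassCurve ℚ) [W.IsElliptic] [W.IsGloballyMinimal] {N : ℕ} [NeZero N]
        (D : ModularParametrizationData W N),
        (∀ z ∈ D.L.lattice, ∃ w ∈ periodLattice D.f, z = D.c * w) → 3 ^ 2 ∣ N → Q W N →
        ¬ (3 : ℤ) ∣ D.maninConstant) →
      Summit.BirchSwinnertonDyer.BirchSwinnertonDyer.Theses.ManinLocalTwoThree.ManinPrimeToThreeAtNine)
    (hK : kato_neron_isIntegral_twistedSymbolSum_of_additive_three_polar) (hG : ShiftClassGenerationThree)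
    (hB : ∀ (W : WeierstrassCurve ℚ) [W.IsElliptic] [W.IsGloballyMinimal] {N : ℕ} [NeZero N]
      (D : ModularParametrizationData W N),
      (∀ z ∈ D.L.lattice, ∃ w ∈ periodLattice D.f, z = D.c * w) → 3 ^ 2 ∣ N →
      Q W N → ¬ W.HasIrreducibleModPGaloisRep 3 → ¬ (3 : ℤ) ∣ D.c)
    : Summit.BirchSwinnertonDyer.BirchSwinnertonDyer.Theses.ManinLocalTwoThree.ManinPrimeToThreeAtNine :=
  maninPrimeToThreeAtNine_of_classReduction_of_katoShift Q hred
    (katoShiftTwistManinThree_of_katoFact_of_generation hK hG) hB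

/-- **Losslessness along a class-predicate reduction** (granted `PrintedSemistableManinFacts`).
[cite: Stevens1989, Lemmas (5.2), (5.4)] -/
theorem maninPrimeToThreeAtNine_iff_split_of_classReduction (hPF : Summit.BirchSwinnertonDyer.BirchSwinnertonDyer.Theses.ManinLocalTwoThree.PrintedSemistableManinFacts)
    (hred : (Literature.NumberTheory.EllipticCurves.ModularForms.mazur_not_dvd_maninConstant_of_odd →
      Literature.NumberTheory.EllipticCurves.ModularForms.abbesUllmo_not_dvd_maninConstant_of_not_dvd_level →
      Literature.NumberTheory.EllipticCurves.ModularForms.cesnavicius_not_two_dvd_maninConstant_of_two_dvd_level →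
      Literature.NumberTheory.EllipticCurves.ModularForms.exists_isNewformOf →
      ∀ (W : WeierstrassCurve ℚ) [W.IsElliptic] [W.IsGloballyMinimal] {N : ℕ} [NeZero N]
        (D : ModularParametrizationData W N),
        (∀ z ∈ D.L.lattice, ∃ w ∈ periodLattice D.f, z = D.c * w) → 3 ^ 2 ∣ N → Q W N →
        ¬ (3 : ℤ) ∣ D.maninConstant) →
      Summit.BirchSwinnertonDyer.BirchSwinnertonDyer.Theses.ManinLocalTwoThree.ManinPrimeToThreeAtNine)
    : Summit.BirchSwinnertonDyer.BirchSwinnertonDyer.Theses.ManinLocalTwoThree.ManinPrimeToThreeAtNine ↔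
      ((∀ (W : WeierstrassCurve ℚ) [W.IsElliptic] [W.IsGloballyMinimal] {N : ℕ} [NeZero N]
        (D : ModularParametrizationData W N),
        (∀ z ∈ D.L.lattice, ∃ w ∈ periodLattice D.f, z = D.c * w) → 3 ^ 2 ∣ N → Q W N →
          W.HasIrreducibleModPGaloisRep 3 → ¬ (3 : ℤ) ∣ D.c) ∧
        (∀ (W : WeierstrassCurve ℚ) [W.IsElliptic] [W.IsGloballyMinimal] {N : ℕ} [NeZero N]
        (D : ModularParametrizationData W N),
        (∀ z ∈ D.L.lattice, ∃ w ∈ periodLattice D.f, z = D.c * w) → 3 ^ 2 ∣ N → Q W N →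
          ¬ W.HasIrreducibleModPGaloisRep 3 → ¬ (3 : ℤ) ∣ D.c)) := by
  obtain ⟨hM, hAU, hC, hnf⟩ := hPF
  refine ⟨fun h3 => ⟨?_, ?_⟩, fun h => maninPrimeToThreeAtNine_of_classReduction_of_split Q hred h.1 h.2⟩
  · intro W _ _ N _ D hopt h9 _ _
    exact h3 hM hAU hC hnf W D hopt h9
  · intro W _ _ N _ D hopt h9 _ _
    exact h3 hM hAU hC hnf W D hopt h9

end ClassPredicate

end Summit.BirchSwinnertonDyer.BirchSwinnertonDyer.Theorems.ManinLocalTwoThree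

end
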